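import Summits.MatrixMultiplication.OmegaCensus.DominoLineUnitObstructionComposite
import Summits.MatrixMultiplication.OmegaCensus.DominoLineUnitObstructionPair

/-!
# Quadratic-ring unit-test certificates for COMPOSITE moduli `m` (`gcd(m,6) = 1`): primes `q` with `θ` of order `m` in `𝔽_q[θ]/(θ² − cθ + 1)`

ω-census `pub-omega`, family (b3), seat pub-omega-stpp-1 gen 23 (complement to `DominoLineUnitObstructionComposite`, lead ruling
L32-17 (1)).  Framing: lottery ticket; floor = certified bounds/negative ranges.  VALUE: the second certificate format of the unit test
(`DominoLineUnitObstructionPair`: `p` prime, primes `q ≡ −1 (mod p)`) for composite `m`; NOT progress on ω.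

For a key `F` over `ZMod m` whose obstruction `D(a_F) = a² + aā + ā²` has only prime factors `q` with `m ∤ q − 1`, the `m`-th root of
unity lives in the quadratic ring `R = (ZMod q)[X]/(X² − cX + 1)` (`c` = image of `ζ + ζ⁻¹`).  `LineM.no_line_identity_of_lineD_eq_zero`
applies verbatim with `r = θ` once `AllGeomZero m θ` is checked, i.e. `Σ_{i<m} θ^{k i} = 0` in `R` for EVERY `0 < k < m` — exact pair
arithmetic over `ℤ` (`mulP`, `powP` of the prime file) and divisibility by `q` of both coordinates:
* `geomPk c m k = Σ_{i<m} θ^{k i}` in pair coordinates; `LineM.unitCert2 m F q c` (a `Bool`): `1 < q`, `q` divides both coordinates of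
  `geomPk c m k` for every `0 < k < m` and of `lineDP c m F`;
* **`LineM.unitCert2_sound`** (`gcd(m,6) = 1`, `1 < m`): then no `G, s, K` satisfy the normalised line identity with key `v ↦ F[v.val]`.
-/

namespace Summit.MatrixMultiplication.OmegaCensus

open Finset Polynomial

namespace LineM

/-! ## The decide side -/

section PairArith

/-- `Σ_{i<m} θ^{k i}` in pair coordinates. [folklore] -/
def geomPk (c : ℤ) (m k : ℕ) : ℤ × ℤ := ∑ i ∈ range m, powP c (k * i)

/-- **Quadratic-ring unit-test certificate for composite `m`** `(q, c)` for the key `F` (list of `m` counts): `1 < q`; `q` divides both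
coordinates of `Σ_{i<m} θ^{k i}` for every `0 < k < m`; and both coordinates of `A² + AB + B²`. [folklore] -/
def unitCert2 (m : ℕ) (F : List ℕ) (q : ℕ) (c : ℤ) : Bool :=
  decide (1 < q ∧ (∀ k ∈ range m, k ≠ 0 → (q : ℤ) ∣ (geomPk c m k).1 ∧ (q : ℤ) ∣ (geomPk c m k).2) ∧
    (q : ℤ) ∣ (lineDP c m F).1 ∧ (q : ℤ) ∣ (lineDP c m F).2)

end PairArith

/-! ## Soundness -/

section Sound

variable {m : ℕ} [NeZero m]

/-- `LineM.lev θ F = ι (levP …)` for the key function `v ↦ F[v.val]`. [folklore] -/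
theorem lev_eq_pairEval_levP {q : ℕ} (c : ℤ) (F : List ℕ) :
    lev (AdjoinRoot.root (quadPoly q c)) (fun v : ZMod m => F.getD v.val 0) =
      pairEval c (AdjoinRoot.root (quadPoly q c)) (levP c m F) := by
  unfold lev levP zch
  rw [map_sum, sum_val_eq_sum_range (fun i => ((F.getD i 0 : ℕ) : AdjoinRoot (quadPoly q c)) *
    (AdjoinRoot.root (quadPoly q c)) ^ i)]
  refine sum_congr rfl fun i _ => ?_
  rw [pairEval_smulP, pairEval_powP, Int.cast_natCast]

/-- `LineM.levc θ F = ι (levcP …)`. [folklore] -/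
theorem levc_eq_pairEval_levcP {q : ℕ} (c : ℤ) (F : List ℕ) :
    levc (AdjoinRoot.root (quadPoly q c)) (fun v : ZMod m => F.getD v.val 0) =
      pairEval c (AdjoinRoot.root (quadPoly q c)) (levcP c m F) := by
  unfold levc levcP zch
  rw [map_sum]
  have e : ∀ v : ZMod m, (-v).val = (m - v.val) % m := fun v => ZMod.neg_val' v
  simp_rw [e]
  rw [sum_val_eq_sum_range (fun i => ((F.getD i 0 : ℕ) : AdjoinRoot (quadPoly q c)) *
    (AdjoinRoot.root (quadPoly q c)) ^ ((m - i) % m))]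
  refine sum_congr rfl fun i _ => ?_
  rw [pairEval_smulP, pairEval_powP, Int.cast_natCast]

/-- **Soundness of the composite quadratic-ring certificate** (`gcd(m,6) = 1`, `1 < m`): `LineM.unitCert2 m F q c = true` excludes
every solution `G, s, K` of the normalised line identity with key `v ↦ F[v.val]`. [folklore] -/
theorem unitCert2_sound (hm6 : Nat.Coprime m 6) (hm1 : 1 < m) {F : List ℕ} {q : ℕ} {c : ℤ} (h : unitCert2 m F q c = true)
    (G : ZMod m → ℕ) (s : ZMod m) (K : ℕ)
    (hid : ∀ τ : ZMod m, (∑ v : ZMod m, ((fun v : ZMod m => F.getD v.val 0) (τ - v) +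
      (fun v : ZMod m => F.getD v.val 0) (v - τ) + (fun v : ZMod m => F.getD v.val 0) (τ + v)) * G v) +
      (if s = τ then 1 else 0) = K) : False := by
  obtain ⟨hq, hg, hd1, hd2⟩ := of_decide_eq_true h
  haveI := nontrivial_adjoinRoot_quadPoly c hq
  set θ := AdjoinRoot.root (quadPoly q c) with hθ
  -- `AllGeomZero m θ`
  have hr : AllGeomZero m θ := by
    intro k hk
    have hk' : k.val ≠ 0 := fun e => hk ((ZMod.val_eq_zero k).1 e)
    obtain ⟨h1, h2⟩ := hg k.val (mem_range.2 (ZMod.val_lt k)) hk'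
    have e : pairEval c θ (geomPk c m k.val) = ∑ i ∈ range m, (zch θ k) ^ i := by
      unfold geomPk
      rw [map_sum]
      exact sum_congr rfl fun i _ => by rw [hθ, pairEval_powP, zch, ← pow_mul]
    rw [← e]
    exact pairEval_eq_zero_of_dvd c θ h1 h2
  -- `D = 0`
  have hD : (lev θ (fun v : ZMod m => F.getD v.val 0)) ^ 2 +
      lev θ (fun v : ZMod m => F.getD v.val 0) * levc θ (fun v : ZMod m => F.getD v.val 0) +
      (levc θ (fun v : ZMod m => F.getD v.val 0)) ^ 2 = 0 := by
    rw [hθ, lev_eq_pairEval_levP, levc_eq_pairEval_levcP, pow_two, pow_two, ← pairEval_mulP, ← pairEval_mulP,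
      ← pairEval_mulP, ← map_add, ← map_add]
    exact pairEval_eq_zero_of_dvd c _ hd1 hd2
  exact no_line_identity_of_lineD_eq_zero hm6 hm1 hr _ hD G s K hid

/-- Worked instance (`m = 25`, `q = 101`, where the root of unity is even rational: `θ = 5` of order `25`, `c = 5 + 5⁻¹ = 5 + 81 = 86`):
the key `1_{5ℤ/25ℤ}` of `LineM.unitCert_example` also passes the pair format. [folklore] -/
theorem unitCert2_example :
    unitCert2 25 [1,0,0,0,0, 1,0,0,0,0, 1,0,0,0,0, 1,0,0,0,0, 1,0,0,0,0] 101 86 = true := by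
  decide +kernel

end Sound

end LineM

end Summit.MatrixMultiplication.OmegaCensus
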